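import Summits.AtomisticToContinuum.FouriersLaw.Theorems.ExtensiveSnapshotIrreversibility.Negative.DegenerateInstances
import HarnessLib

/-!
# Crux `ExtensiveSnapshotIrreversibility` (stmt-AtomisticToContinuum-9121), line `clausius-budget-sound-window`:
stub S1g `stub_oddLogDensity_of_regularity` — helper file (dominated-convergence bookkeeping)

Support lemmas for the registered stub S1g of the lead's checked skeleton (v6) of the line: the
regularity statement S1r of the NESS log-density (`μ_δ = μ_T · e^{φ_δ}` with `|φ_δ| ≤ η(1 + H)`,
`|φ_δ| ≤ C|δ|(1 + H)^k`, `φ_δ/δ → h₀` pointwise) implies the quadratic-mean first-order control of the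
odd log-density (S1d). This file carries the purely analytic half, for the pinned anharmonic chain
`P = pinnedChain ω₂ lam β γ` at temperature `T > 0` (Gibbs state `μ_T = P.gibbsMeasure N T`, flip
`Θ(q, p) = (q, -p)`):

* elementary inequalities `|e^u − 1| ≤ |u| e^{|u|}`, `(1 + t)^n ≤ (n! e^s / s^n) e^{st}`;
* polynomial × exponential moments `(1 + H)^n e^{aH} ∈ L¹(μ_T)` for `a < 1/T`
  (`pinnedChain_integrable_exp_mul_hamiltonian_gibbsMeasure`);
* DCT #1 (`tendsto_integral_flipQuot_sq_mul_exp`):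
  `∫ ((φ_δ − φ_δ∘Θ)/δ)² e^{φ_δ} dμ_T → ∫ (h₀ − h₀∘Θ)² dμ_T` along `δ → 0`, `δ ≠ 0`
  (domination by `4C²(1 + H)^{2k} e^{η(1+H)}`);
* DCT #2 (`tendsto_diffQuot_integral_of_regularity`, differentiation under the integral sign): if
  `ν_δ = μ_T · e^{φ_δ}` for `0 < |δ| < δ₀`, then for every continuous compactly supported `F`,
  `(∫ F dν_δ − ∫ F dμ_T)/δ = ∫ F (e^{φ_δ} − 1)/δ dμ_T → ∫ F h₀ dμ_T` (domination by
  `‖F‖_∞ C(1 + H)^k e^{η(1+H)}`, pointwise limit through `dslope exp 0`).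

The closed form `oddLogDensity_quadraticMeanLimit` of DCT #1 is the registered sub-goal of the item served by this file.
No new definitions. References: J. A. McLennan, Phys. Rev. 115 (1959) 1405; C. Maes, K. Netočný,
J. Math. Phys. 51 (2010) 015219 (the McLennan/linear-response log-density).
-/

noncomputable section

namespace Summit.AtomisticToContinuum.FouriersLaw.Theorems.ExtensiveSnapshotIrreversibility.ClausiusBudget

open MeasureTheory Filter Topology Real
open scoped ENNReal NNReal
open Literature.MathematicalPhysics.KineticTheory.HeatConduction
open Summit.AtomisticToContinuum.FouriersLaw.Theorems.ExtensiveSnapshotIrreversibility.Negative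

namespace OddLogDensity

/-! ## 1. Elementary real inequalities and filters -/

/-- `|e^u − 1| ≤ |u| e^{|u|}` for every real `u` (from `1 + x ≤ eˣ` at `x = u` and `x = −u`).
[folklore] -/
theorem abs_exp_sub_one_le_abs_mul_exp_abs (u : ℝ) : |exp u - 1| ≤ |u| * exp |u| := by
  rcases le_total 0 u with hu | hu
  · have h0 : 0 ≤ exp u - 1 := by linarith [add_one_le_exp u]
    rw [abs_of_nonneg hu, abs_of_nonneg h0]
    have h1 := mul_le_mul_of_nonneg_right (add_one_le_exp (-u)) (exp_pos u).le
    rw [← exp_add, neg_add_cancel, exp_zero] at h1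
    nlinarith [h1]
  · have h0 : exp u - 1 ≤ 0 := by linarith [exp_le_one_iff.mpr hu]
    rw [abs_of_nonpos hu, abs_of_nonpos h0]
    have h1 := add_one_le_exp u
    have h2 : 1 ≤ exp (-u) := one_le_exp (by linarith)
    nlinarith [mul_le_mul_of_nonneg_left h2 (neg_nonneg.mpr hu)]

/-- `(1 + t)^n ≤ (n! e^s / s^n) e^{s t}` for `t ≥ 0`, `s > 0` (`xⁿ/n! ≤ eˣ` at `x = s(1 + t)`).
[folklore] -/
theorem one_add_pow_le_factorial_mul_exp (n : ℕ) {t s : ℝ} (ht : 0 ≤ t) (hs : 0 < s) :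
    (1 + t) ^ n ≤ (n.factorial * exp s / s ^ n) * exp (s * t) := by
  -- adapted from `…Theorems.LightConeBondHeat.one_add_pow_le_exp` (same tree, other route)
  have h := pow_div_factorial_le_exp (s * (1 + t)) (by positivity) n
  have h2 : exp (s * (1 + t)) = exp s * exp (s * t) := by
    rw [mul_add, mul_one, exp_add]
  rw [mul_pow, h2] at h
  have hm : (0 : ℝ) < n.factorial := by exact_mod_cast n.factorial_pos
  have hsm : 0 < s ^ n := pow_pos hs n
  rw [div_le_iff₀ hm] at h
  rw [div_mul_eq_mul_div, le_div_iff₀ hsm]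
  calc (1 + t) ^ n * s ^ n = s ^ n * (1 + t) ^ n := by ring
    _ ≤ exp s * exp (s * t) * n.factorial := h
    _ = n.factorial * exp s * exp (s * t) := by ring

/-- Near `0` in the punctured sense: `δ ≠ 0` and `|δ| < δ₀`. [folklore] -/
theorem eventually_ne_and_abs_lt {δ₀ : ℝ} (hδ₀ : 0 < δ₀) :
    ∀ᶠ δ in 𝓝[≠] (0 : ℝ), δ ≠ 0 ∧ |δ| < δ₀ := by
  have h1 : ∀ᶠ δ in 𝓝 (0 : ℝ), |δ| < δ₀ := by
    have hlt : ∀ᶠ δ in 𝓝 (0 : ℝ), δ < δ₀ := eventually_lt_nhds hδ₀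
    have hgt : ∀ᶠ δ in 𝓝 (0 : ℝ), -δ₀ < δ := eventually_gt_nhds (by linarith)
    filter_upwards [hlt, hgt] with δ h1 h2
    exact abs_lt.mpr ⟨h2, h1⟩
  filter_upwards [self_mem_nhdsWithin, mem_nhdsWithin_of_mem_nhds h1] with δ hδ hδ'
  exact ⟨hδ, hδ'⟩

/-- If `u(δ)/δ → a` along `δ → 0`, `δ ≠ 0`, then `u(δ) → 0`. [folklore] -/
theorem tendsto_zero_of_tendsto_div {u : ℝ → ℝ} {a : ℝ}
    (hu : Tendsto (fun δ => u δ / δ) (𝓝[≠] 0) (𝓝 a)) : Tendsto u (𝓝[≠] 0) (𝓝 0) := by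
  have hid : Tendsto (fun δ : ℝ => δ) (𝓝[≠] (0 : ℝ)) (𝓝 0) :=
    tendsto_nhdsWithin_of_tendsto_nhds tendsto_id
  have h := hu.mul hid
  rw [mul_zero] at h
  refine h.congr' ?_
  filter_upwards [self_mem_nhdsWithin] with δ hδ
  exact div_mul_cancel₀ (u δ) hδ

/-- If `u(δ)/δ → a` along `δ → 0`, `δ ≠ 0`, then `(e^{u(δ)} − 1)/δ → a` (chain rule at `0` through the
continuous extension `dslope exp 0` of the difference quotient of `exp`). [folklore] -/
theorem tendsto_exp_sub_one_div {u : ℝ → ℝ} {a : ℝ}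
    (hu : Tendsto (fun δ => u δ / δ) (𝓝[≠] 0) (𝓝 a)) :
    Tendsto (fun δ => (exp (u δ) - 1) / δ) (𝓝[≠] 0) (𝓝 a) := by
  have hu0 := tendsto_zero_of_tendsto_div hu
  have hds : ContinuousAt (dslope exp 0) 0 := continuousAt_dslope_same.mpr differentiableAt_exp
  have hds0 : dslope exp 0 0 = 1 := by rw [dslope_same, Real.deriv_exp, exp_zero]
  have h2 : Tendsto (fun δ => dslope exp 0 (u δ)) (𝓝[≠] 0) (𝓝 (dslope exp 0 0)) :=
    hds.tendsto.comp hu0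
  rw [hds0] at h2
  have h3 := hu.mul h2
  rw [mul_one] at h3
  refine h3.congr' (Eventually.of_forall fun δ => ?_)
  have := sub_smul_dslope exp 0 (u δ)
  rw [sub_zero, smul_eq_mul, exp_zero] at this
  show _ = (exp (u δ) - 1) / δ
  rw [← this]
  ring

/-- A limit `a = lim u(δ)/δ` of quotients with `|u(δ)| ≤ C|δ|B` for `|δ| < δ₀` obeys `|a| ≤ C B`.
[folklore] -/
theorem abs_le_of_tendsto_div {u : ℝ → ℝ} {a C B δ₀ : ℝ} (hδ₀ : 0 < δ₀)
    (hu : Tendsto (fun δ => u δ / δ) (𝓝[≠] 0) (𝓝 a))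
    (hb : ∀ δ : ℝ, |δ| < δ₀ → |u δ| ≤ C * |δ| * B) : |a| ≤ C * B := by
  refine le_of_tendsto hu.abs ?_
  filter_upwards [eventually_ne_and_abs_lt hδ₀] with δ hδ
  rw [abs_div, div_le_iff₀ (abs_pos.mpr hδ.1)]
  calc |u δ| ≤ C * |δ| * B := hb δ hδ.2
    _ = C * B * |δ| := by ring

/-- Pointwise domination for DCT #1: if `|a|, |b| ≤ C|δ|(1 + E)^k` and `|a| ≤ η(1 + E)` then
`((a − b)/δ)² e^a ≤ (2C(1 + E)^k)² e^{η(1+E)}`. [folklore] -/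
theorem flipQuot_sq_mul_exp_le {a b δ C η E : ℝ} {k : ℕ} (hδ : δ ≠ 0)
    (ha : |a| ≤ C * |δ| * (1 + E) ^ k) (hb : |b| ≤ C * |δ| * (1 + E) ^ k)
    (ha' : |a| ≤ η * (1 + E)) :
    ((a - b) / δ) ^ 2 * exp a ≤ (2 * C * (1 + E) ^ k) ^ 2 * exp (η * (1 + E)) := by
  have hδ' : 0 < |δ| := abs_pos.mpr hδ
  have h1 : |(a - b) / δ| ≤ 2 * C * (1 + E) ^ k := by
    rw [abs_div, div_le_iff₀ hδ']
    calc |a - b| ≤ |a| + |b| := abs_sub a b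
      _ ≤ C * |δ| * (1 + E) ^ k + C * |δ| * (1 + E) ^ k := add_le_add ha hb
      _ = 2 * C * (1 + E) ^ k * |δ| := by ring
  have h2 : ((a - b) / δ) ^ 2 ≤ (2 * C * (1 + E) ^ k) ^ 2 := by
    rw [← sq_abs]
    exact pow_le_pow_left₀ (abs_nonneg _) h1 2
  have h3 : exp a ≤ exp (η * (1 + E)) := exp_le_exp.mpr ((le_abs_self a).trans ha')
  exact mul_le_mul h2 h3 (exp_pos a).le (sq_nonneg _)

/-- Pointwise domination for DCT #2: if `|a| ≤ C|δ|(1 + E)^k`, `|a| ≤ η(1 + E)` (`C ≥ 0`, `E ≥ 0`)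
then `|(e^a − 1)/δ| ≤ C(1 + E)^k e^{η(1+E)}`. [folklore] -/
theorem abs_exp_sub_one_div_le {a δ C η E : ℝ} {k : ℕ} (hδ : δ ≠ 0) (hE : 0 ≤ E) (hC : 0 ≤ C)
    (ha : |a| ≤ C * |δ| * (1 + E) ^ k) (ha' : |a| ≤ η * (1 + E)) :
    |(exp a - 1) / δ| ≤ C * (1 + E) ^ k * exp (η * (1 + E)) := by
  have hδ' : 0 < |δ| := abs_pos.mpr hδ
  rw [abs_div, div_le_iff₀ hδ']
  calc |exp a - 1| ≤ |a| * exp |a| := abs_exp_sub_one_le_abs_mul_exp_abs a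
    _ ≤ (C * |δ| * (1 + E) ^ k) * exp (η * (1 + E)) :=
        mul_le_mul ha (exp_le_exp.mpr ha') (exp_pos _).le (by positivity)
    _ = C * (1 + E) ^ k * exp (η * (1 + E)) * |δ| := by ring

/-! ## 2. Polynomial × exponential moments of the Gibbs state -/

section Gibbs

variable {ω₂ lam β : ℝ} (hω : 0 < ω₂) (hl : 0 ≤ lam) (hβ : 0 ≤ β) (γ : ℝ) (N : ℕ) {T : ℝ} (hT : 0 < T)
include hω hl hβ hT

/-- `(1 + H)^n e^{aH} ∈ L¹(μ_T)` for every `n` and every `a < 1/T` (`(1 + H)^n ≤ c_s e^{sH}` with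
`a + s < 1/T`, and `e^{ϑH} ∈ L¹(μ_T)` for `ϑ < 1/T`). [folklore] -/
theorem integrable_one_add_pow_mul_exp_gibbs (n : ℕ) {a : ℝ} (ha : a < 1 / T) :
    Integrable (fun x => (1 + (pinnedChain ω₂ lam β γ).hamiltonian N x) ^ n *
        exp (a * (pinnedChain ω₂ lam β γ).hamiltonian N x))
      ((pinnedChain ω₂ lam β γ).gibbsMeasure N T) := by
  set P := pinnedChain ω₂ lam β γ with hP
  set s : ℝ := (1 / T - a) / 2 with hs_def
  have hs : 0 < s := by rw [hs_def]; linarith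
  have has : a + s < 1 / T := by rw [hs_def]; linarith
  have hint := (pinnedChain_integrable_exp_mul_hamiltonian_gibbsMeasure hω hl hβ γ N hT has).const_mul
    (n.factorial * exp s / s ^ n)
  have hHc : Continuous (P.hamiltonian N) := pinnedChain_continuous_hamiltonian ω₂ lam β γ N
  refine hint.mono'
    (((continuous_const.add hHc).pow n).mul
      (continuous_exp.comp (continuous_const.mul hHc))).aestronglyMeasurable
    (Eventually.of_forall fun x => ?_)
  have hH := pinnedChain_hamiltonian_nonneg hω.le hl hβ γ N x
  rw [Real.norm_eq_abs, abs_of_nonneg (by positivity)]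
  have h1 := one_add_pow_le_factorial_mul_exp n hH hs
  calc (1 + P.hamiltonian N x) ^ n * exp (a * P.hamiltonian N x)
      ≤ (n.factorial * exp s / s ^ n) * exp (s * P.hamiltonian N x) * exp (a * P.hamiltonian N x) :=
        mul_le_mul_of_nonneg_right h1 (exp_pos _).le
    _ = (n.factorial * exp s / s ^ n) * exp ((a + s) * P.hamiltonian N x) := by
        rw [mul_assoc, ← exp_add]
        congr 2
        ring

/-- A measurable function dominated by `C(1 + H)^k` is `μ_T`-integrable. [folklore] -/
theorem integrable_of_abs_le_mul_one_add_pow {f : PhaseSpace N → ℝ} {C : ℝ} {k : ℕ}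
    (hfm : AEStronglyMeasurable f ((pinnedChain ω₂ lam β γ).gibbsMeasure N T))
    (hf : ∀ x, |f x| ≤ C * (1 + (pinnedChain ω₂ lam β γ).hamiltonian N x) ^ k) :
    Integrable f ((pinnedChain ω₂ lam β γ).gibbsMeasure N T) := by
  have hi := (integrable_one_add_pow_mul_exp_gibbs hω hl hβ γ N hT k (a := 0) (by positivity)).const_mul C
  refine hi.mono' hfm (Eventually.of_forall fun x => ?_)
  rw [Real.norm_eq_abs]
  refine (hf x).trans (le_of_eq ?_)
  simp only [zero_mul, exp_zero, mul_one]

/-- A measurable function dominated by `M e^{η(1+H)}` with `η < 1/T` is `μ_T`-integrable; used for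
`e^{ψ} F` with `|ψ| ≤ η(1 + H)` and `|F| ≤ M`. [folklore] -/
theorem integrable_exp_mul_of_abs_le {η : ℝ} (hηT : η < 1 / T) {ψ F : PhaseSpace N → ℝ}
    (hψm : Measurable ψ) (hψ : ∀ x, |ψ x| ≤ η * (1 + (pinnedChain ω₂ lam β γ).hamiltonian N x))
    (hFm : AEStronglyMeasurable F ((pinnedChain ω₂ lam β γ).gibbsMeasure N T)) {M : ℝ}
    (hFM : ∀ x, |F x| ≤ M) :
    Integrable (fun x => exp (ψ x) * F x) ((pinnedChain ω₂ lam β γ).gibbsMeasure N T) := by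
  have hi := (pinnedChain_integrable_exp_mul_hamiltonian_gibbsMeasure hω hl hβ γ N hT hηT).const_mul
    (exp η * M)
  refine hi.mono' (hψm.exp.aestronglyMeasurable.mul hFm) (Eventually.of_forall fun x => ?_)
  rw [Real.norm_eq_abs, abs_mul, abs_of_pos (exp_pos _)]
  have hM : 0 ≤ M := (abs_nonneg _).trans (hFM x)
  have h1 : exp (ψ x) ≤ exp η * exp (η * (pinnedChain ω₂ lam β γ).hamiltonian N x) := by
    rw [← exp_add]
    refine exp_le_exp.mpr (((le_abs_self _).trans (hψ x)).trans (le_of_eq ?_))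
    ring
  calc exp (ψ x) * |F x| ≤ (exp η * exp (η * (pinnedChain ω₂ lam β γ).hamiltonian N x)) * M :=
        mul_le_mul h1 (hFM x) (abs_nonneg _) (by positivity)
    _ = exp η * M * exp (η * (pinnedChain ω₂ lam β γ).hamiltonian N x) := by ring

/-! ## 3. DCT #1: the quadratic-mean limit of the odd quotient -/

variable {δ₀ η C : ℝ} {k : ℕ} (hδ₀ : 0 < δ₀) (hηT : η < 1 / T)
  {φ : ℝ → PhaseSpace N → ℝ} {h₀ : PhaseSpace N → ℝ} (hφm : ∀ δ : ℝ, Measurable (φ δ))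
  (hR2 : ∀ δ : ℝ, |δ| < δ₀ → ∀ x : PhaseSpace N,
    |φ δ x| ≤ η * (1 + (pinnedChain ω₂ lam β γ).hamiltonian N x))
  (hR3 : ∀ δ : ℝ, |δ| < δ₀ → ∀ x : PhaseSpace N,
    |φ δ x| ≤ C * |δ| * (1 + (pinnedChain ω₂ lam β γ).hamiltonian N x) ^ k)

omit hω hl hβ hT in
include hR2 hR3 in
/-- The domination of DCT #1: for `0 < |δ| < δ₀`,
`((φ_δ − φ_δ∘Θ)/δ)² e^{φ_δ} ≤ (2C(1 + H)^k)² e^{η(1+H)}` (`H∘Θ = H`). [folklore] -/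
theorem norm_flipQuot_sq_mul_exp_le {δ : ℝ} (hδ : δ ≠ 0) (hδ' : |δ| < δ₀) (x : PhaseSpace N) :
    ‖((φ δ x - φ δ (x.1, -x.2)) / δ) ^ 2 * exp (φ δ x)‖ ≤
      (2 * C * (1 + (pinnedChain ω₂ lam β γ).hamiltonian N x) ^ k) ^ 2 *
        exp (η * (1 + (pinnedChain ω₂ lam β γ).hamiltonian N x)) := by
  rw [Real.norm_eq_abs, abs_of_nonneg (mul_nonneg (sq_nonneg _) (exp_pos _).le)]
  have hb := hR3 δ hδ' (x.1, -x.2)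
  rw [OscillatorChain.hamiltonian_neg_momentum] at hb
  exact flipQuot_sq_mul_exp_le hδ (hR3 δ hδ' x) hb (hR2 δ hδ' x)

include hηT hφm hR2 hR3 in
/-- For `0 < |δ| < δ₀` the dominated integrand of DCT #1 is `μ_T`-integrable. [folklore] -/
theorem integrable_flipQuot_sq_mul_exp {δ : ℝ} (hδ : δ ≠ 0) (hδ' : |δ| < δ₀) :
    Integrable (fun x => ((φ δ x - φ δ (x.1, -x.2)) / δ) ^ 2 * exp (φ δ x))
      ((pinnedChain ω₂ lam β γ).gibbsMeasure N T) := by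
  have hΘm : Measurable (fun y : PhaseSpace N => ((y.1, -y.2) : PhaseSpace N)) :=
    measurable_fst.prodMk measurable_snd.neg
  have hi := (integrable_one_add_pow_mul_exp_gibbs hω hl hβ γ N hT (2 * k) hηT).const_mul
    ((2 * C) ^ 2 * exp η)
  refine hi.mono'
    (((((hφm δ).sub ((hφm δ).comp hΘm)).div_const δ).pow_const 2).mul
      (hφm δ).exp).aestronglyMeasurable (Eventually.of_forall fun x => ?_)
  refine (norm_flipQuot_sq_mul_exp_le γ N hR2 hR3 hδ hδ' x).trans (le_of_eq ?_)
  have : exp (η * (1 + (pinnedChain ω₂ lam β γ).hamiltonian N x)) =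
      exp η * exp (η * (pinnedChain ω₂ lam β γ).hamiltonian N x) := by
    rw [← exp_add]; ring_nf
  rw [this]; ring

include hδ₀ hηT hφm hR2 hR3 in
/-- **DCT #1.** Under (R2), (R3) and the pointwise derivative (R4) `φ_δ/δ → h₀`:
`∫ ((φ_δ − φ_δ∘Θ)/δ)² e^{φ_δ} dμ_T → ∫ (h₀ − h₀∘Θ)² dμ_T` along `δ → 0`, `δ ≠ 0`
(`e^{φ_δ} → 1` pointwise since `|φ_δ| ≤ C|δ|(1 + H)^k`). [folklore] -/
theorem tendsto_integral_flipQuot_sq_mul_exp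
    (hR4 : ∀ x : PhaseSpace N, Tendsto (fun δ : ℝ => φ δ x / δ) (𝓝[≠] (0 : ℝ)) (𝓝 (h₀ x))) :
    Tendsto (fun δ : ℝ => ∫ x, ((φ δ x - φ δ (x.1, -x.2)) / δ) ^ 2 * exp (φ δ x)
        ∂(pinnedChain ω₂ lam β γ).gibbsMeasure N T) (𝓝[≠] (0 : ℝ))
      (𝓝 (∫ x, (h₀ x - h₀ (x.1, -x.2)) ^ 2 ∂(pinnedChain ω₂ lam β γ).gibbsMeasure N T)) := by
  have hΘm : Measurable (fun y : PhaseSpace N => ((y.1, -y.2) : PhaseSpace N)) :=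
    measurable_fst.prodMk measurable_snd.neg
  refine tendsto_integral_filter_of_dominated_convergence
    (fun x => (2 * C * (1 + (pinnedChain ω₂ lam β γ).hamiltonian N x) ^ k) ^ 2 *
      exp (η * (1 + (pinnedChain ω₂ lam β γ).hamiltonian N x))) ?_ ?_ ?_ ?_
  · exact Eventually.of_forall fun δ =>
      (((((hφm δ).sub ((hφm δ).comp hΘm)).div_const δ).pow_const 2).mul
        (hφm δ).exp).aestronglyMeasurable
  · filter_upwards [eventually_ne_and_abs_lt hδ₀] with δ hδ
    exact ae_of_all _ fun x => norm_flipQuot_sq_mul_exp_le γ N hR2 hR3 hδ.1 hδ.2 x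
  · have hi := (integrable_one_add_pow_mul_exp_gibbs hω hl hβ γ N hT (2 * k) hηT).const_mul
      ((2 * C) ^ 2 * exp η)
    refine hi.congr (Eventually.of_forall fun x => ?_)
    have : exp (η * (1 + (pinnedChain ω₂ lam β γ).hamiltonian N x)) =
        exp η * exp (η * (pinnedChain ω₂ lam β γ).hamiltonian N x) := by
      rw [← exp_add]; ring_nf
    simp only [this]; ring
  · refine ae_of_all _ fun x => ?_
    have h1 : Tendsto (fun δ : ℝ => (φ δ x - φ δ (x.1, -x.2)) / δ) (𝓝[≠] (0 : ℝ))
        (𝓝 (h₀ x - h₀ (x.1, -x.2))) := by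
      simp_rw [sub_div]
      exact (hR4 x).sub (hR4 (x.1, -x.2))
    have h2 : Tendsto (fun δ : ℝ => exp (φ δ x)) (𝓝[≠] (0 : ℝ)) (𝓝 (exp 0)) :=
      (continuous_exp.tendsto 0).comp (tendsto_zero_of_tendsto_div (hR4 x))
    rw [exp_zero] at h2
    have := (h1.pow 2).mul h2
    rwa [mul_one] at this

/-! ## 4. DCT #2: `h₀` is a weak `δ`-derivative tested on bounded continuous functions -/

include hδ₀ hηT hφm hR2 hR3 in
/-- **DCT #2 (differentiation under the integral sign).** If `ν_δ = μ_T · e^{φ_δ}` for `0 < |δ| < δ₀`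
with (R2), (R3), (R4) (`C ≥ 0`), then for every continuous compactly supported `F`:
`(∫ F dν_δ − ∫ F dμ_T)/δ = ∫ F (e^{φ_δ} − 1)/δ dμ_T → ∫ F h₀ dμ_T`. [folklore] -/
theorem tendsto_diffQuot_integral_of_regularity (hC : 0 ≤ C)
    (hR4 : ∀ x : PhaseSpace N, Tendsto (fun δ : ℝ => φ δ x / δ) (𝓝[≠] (0 : ℝ)) (𝓝 (h₀ x)))
    {ν : ℝ → Measure (PhaseSpace N)}
    (hν : ∀ δ : ℝ, δ ≠ 0 → |δ| < δ₀ → ν δ =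
      ((pinnedChain ω₂ lam β γ).gibbsMeasure N T).withDensity (fun x => ENNReal.ofReal (exp (φ δ x))))
    {F : PhaseSpace N → ℝ} (hF : Continuous F) (hFc : HasCompactSupport F) :
    Tendsto (fun δ : ℝ => ((∫ x, F x ∂(ν δ)) - ∫ x, F x ∂(pinnedChain ω₂ lam β γ).gibbsMeasure N T) / δ)
      (𝓝[≠] (0 : ℝ)) (𝓝 (∫ x, F x * h₀ x ∂(pinnedChain ω₂ lam β γ).gibbsMeasure N T)) := by
  set μT := (pinnedChain ω₂ lam β γ).gibbsMeasure N T with hμT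
  haveI : IsProbabilityMeasure μT := pinnedChain_isProbabilityMeasure_gibbsMeasure hω hl hβ γ N hT
  obtain ⟨M, hM⟩ := hF.bounded_above_of_compact_support hFc
  have hFM : ∀ x, |F x| ≤ M := fun x => (Real.norm_eq_abs _).symm.le.trans (hM x)
  have hM0 : 0 ≤ M := (norm_nonneg _).trans (hM 0)
  have hFi : Integrable F μT := hF.integrable_of_hasCompactSupport hFc
  have hH0 : ∀ x, 0 ≤ (pinnedChain ω₂ lam β γ).hamiltonian N x :=
    fun x => pinnedChain_hamiltonian_nonneg hω.le hl hβ γ N x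
  -- the limit of `∫ F (e^{φ_δ} − 1)/δ dμ_T`
  have key : Tendsto (fun δ : ℝ => ∫ x, F x * ((exp (φ δ x) - 1) / δ) ∂μT) (𝓝[≠] (0 : ℝ))
      (𝓝 (∫ x, F x * h₀ x ∂μT)) := by
    refine tendsto_integral_filter_of_dominated_convergence
      (fun x => M * (C * (1 + (pinnedChain ω₂ lam β γ).hamiltonian N x) ^ k *
        exp (η * (1 + (pinnedChain ω₂ lam β γ).hamiltonian N x)))) ?_ ?_ ?_ ?_
    · exact Eventually.of_forall fun δ =>
        hF.aestronglyMeasurable.mul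
          ((((hφm δ).exp.sub measurable_const).div_const δ).aestronglyMeasurable)
    · filter_upwards [eventually_ne_and_abs_lt hδ₀] with δ hδ
      refine ae_of_all _ fun x => ?_
      rw [Real.norm_eq_abs, abs_mul]
      exact mul_le_mul (hFM x) (abs_exp_sub_one_div_le hδ.1 (hH0 x) hC (hR3 δ hδ.2 x) (hR2 δ hδ.2 x))
        (abs_nonneg _) hM0
    · have hi := (integrable_one_add_pow_mul_exp_gibbs hω hl hβ γ N hT k hηT).const_mul
        (M * C * exp η)
      refine hi.congr (Eventually.of_forall fun x => ?_)
      have : exp (η * (1 + (pinnedChain ω₂ lam β γ).hamiltonian N x)) =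
          exp η * exp (η * (pinnedChain ω₂ lam β γ).hamiltonian N x) := by
        rw [← exp_add]; ring_nf
      simp only [this]; ring
    · exact ae_of_all _ fun x => (tendsto_exp_sub_one_div (hR4 x)).const_mul (F x)
  refine key.congr' ?_
  filter_upwards [eventually_ne_and_abs_lt hδ₀] with δ hδ
  have hflt : ∀ᵐ x ∂μT, ENNReal.ofReal (exp (φ δ x)) < ∞ :=
    Eventually.of_forall fun _ => ENNReal.ofReal_lt_top
  rw [hν δ hδ.1 hδ.2, integral_withDensity_eq_integral_toReal_smul (hφm δ).exp.ennreal_ofReal hflt]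
  have hpt : ∀ x, (ENNReal.ofReal (exp (φ δ x))).toReal • F x = exp (φ δ x) * F x := fun x => by
    rw [ENNReal.toReal_ofReal (exp_pos _).le, smul_eq_mul]
  simp_rw [hpt]
  have heF : Integrable (fun x => exp (φ δ x) * F x) μT :=
    integrable_exp_mul_of_abs_le hω hl hβ γ N hT hηT (hφm δ) (hR2 δ hδ.2) hF.aestronglyMeasurable hFM
  rw [← integral_sub heF hFi, ← integral_div]
  refine integral_congr_ae (ae_of_all _ fun x => ?_)
  ring

end Gibbs

end OddLogDensity

/-! ## 5. Registered sub-goal (closed form of DCT #1) -/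

open OddLogDensity in
/-- **Registered sub-goal `oddLogDensity_quadraticMeanLimit`** of crux stmt-AtomisticToContinuum-9121 (under
`stub_oddLogDensity_of_regularity`): `OddLogDensity.tendsto_integral_flipQuot_sq_mul_exp` in closed form — for the
pinned chain (`ω₂ > 0`, `lam, β ≥ 0`, `T > 0`), measurable `φ_δ` with `|φ_δ| ≤ η(1 + H)` (`η < 1/T`),
`|φ_δ| ≤ C|δ|(1 + H)^k` on `|δ| < δ₀` and `φ_δ/δ → h₀` pointwise:
`∫ ((φ_δ − φ_δ∘Θ)/δ)² e^{φ_δ} dμ_T → ∫ (h₀ − h₀∘Θ)² dμ_T` along `δ → 0`, `δ ≠ 0`. [folklore] -/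
theorem oddLogDensity_quadraticMeanLimit : ∀ ω₂ lam β γ : ℝ, 0 < ω₂ → 0 ≤ lam → 0 ≤ β → ∀ (N : ℕ) (T : ℝ), 0 < T → ∀ (δ₀ η C : ℝ) (k : ℕ), 0 < δ₀ → η < 1 / T → ∀ (φ : ℝ → PhaseSpace N → ℝ) (h₀ : PhaseSpace N → ℝ), (∀ δ : ℝ, Measurable (φ δ)) → (∀ δ : ℝ, |δ| < δ₀ → ∀ x : PhaseSpace N, |φ δ x| ≤ η * (1 + (pinnedChain ω₂ lam β γ).hamiltonian N x)) → (∀ δ : ℝ, |δ| < δ₀ → ∀ x : PhaseSpace N, |φ δ x| ≤ C * |δ| * (1 + (pinnedChain ω₂ lam β γ).hamiltonian N x) ^ k) → (∀ x : PhaseSpace N, Tendsto (fun δ : ℝ => φ δ x / δ) (𝓝[≠] (0 : ℝ)) (𝓝 (h₀ x))) → Tendsto (fun δ : ℝ => ∫ x, ((φ δ x - φ δ (x.1, -x.2)) / δ) ^ 2 * Real.exp (φ δ x) ∂(pinnedChain ω₂ lam β γ).gibbsMeasure N T) (𝓝[≠] (0 : ℝ)) (𝓝 (∫ x, (h₀ x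 - h₀ (x.1, -x.2)) ^ 2 ∂(pinnedChain ω₂ lam β γ).gibbsMeasure N T)) :=
  fun _ _ _ γ hω hl hβ N _ hT _ _ _ _ hδ₀ hηT _ _ hφm hR2 hR3 hR4 =>
    tendsto_integral_flipQuot_sq_mul_exp hω hl hβ γ N hT hδ₀ hηT hφm hR2 hR3 hR4

end Summit.AtomisticToContinuum.FouriersLaw.Theorems.ExtensiveSnapshotIrreversibility.ClausiusBudget

end
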